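import Mathlib
import HarnessLib

/-!
# Stub (conn) `stub_raynaudConnectivity`, combinatorial half: chains / crossings of components ⟹
# the `conn` hypothesis of `Theorems.proMod_of_propagation`

Route `SkinnerWilesDefectOne`, crux `ReducibleOrdinaryProModular` (stmt-Langlands-12919), line
`fine-selmer-codimension-two` (lead skeleton v3,
`Cruxes/ReducibleOrdinaryProModular/Lines/fine_selmer_codimension_two.lean`), registered stub
`stub_raynaudConnectivity` (Raynaud connectivity at margin one).  The stub asserts, for the universal
ring `R = R_𝒟` of an SW-oriented model: whenever the minimal primes of `R` are two-coloured with both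
colours used, two minimal primes of different colours lie below a common BIG prime.  Its intended proof
([SW, §4.3, p. 64]; [SW, App. A, Cor. A.2] = Grothendieck's connectedness theorem SGA2 XIII 2.1) has a
purely combinatorial last step, landed here sorry-free for an ARBITRARY commutative ring `R` and an
ARBITRARY predicate `Big` on `Spec R`:

* `Relation.ReflTransGen.exists_mem_notMem` — two-colouring a chain: if `a ∈ S`, `b ∉ S` and
  `a, b` are joined by an `r`-chain, some `r`-step leaves `S`;
* `Theorems.conn_of_forall_minimalPrimes_reflTransGen` and its registered alias
  `stub_raynaudConnectivity_auxChain` — CHAIN FORM: if any two minimal primes are linked by a finite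
  chain of minimal primes whose consecutive members lie pairwise below a big prime, `conn` holds;
* `Theorems.exists_minimalPrimes_le_ringKrullDim_quotient` — if `n ≤ dim R/J` then some minimal
  prime `Q` of `J` has `n ≤ dim R/Q` (the generic point of a top-dimensional component of `V(J)`);
* `Theorems.conn_of_crossings` and its registered alias `stub_raynaudConnectivity_auxCrossing` —
  CROSSING FORM (the shape Grothendieck's theorem delivers): if `Spec R` is connected in dimension
  `n` (for every two-colouring of the minimal primes, two minimal primes `C₁, C₂` of different colours
  have `n ≤ dim R/(C₁ + C₂)`) and the generic points `Q` of the `≥ n`-dimensional components of such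
  crossings `V(C₁) ∩ V(C₂)` are big, `conn` holds.

What remains of the stub after this file is therefore exactly: (R) connectedness of `Spec R_𝒟` in
dimension `3` (Grothendieck's theorem applied to a presentation `R_𝒟 ≅ A/(f₁,…,f_r)`, `A` complete
local Cohen–Macaulay, `dim A − r = 4`) and (B) bigness of the generic points of the 3-dimensional
crossings (the line's margin-one bet) — see the worker report.

References: C. M. Skinner, A. J. Wiles, *Residually reducible representations and modular forms*,
Publ. Math. IHÉS 89 (1999) 5–126, §4.3 (proof of Prop. 4.1), App. A [SkinnerWiles1999];
A. Grothendieck, SGA 2, Exp. XIII, Thm. 2.1 [Grothendieck1968SGA2]; M. Brodmann, R. Sharp, *Local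
cohomology*, CUP 1998, Ch. 19 [BrodmannSharp1998].
-/

set_option linter.dupNamespace false -- project-wide option (lakefile weak.linter.dupNamespace); `Summit.Langlands.Langlands` is the mandated namespace
set_option autoImplicit false

/-! ## 1. Two-colouring a chain -/

/-- **Two-colouring a chain.**  If `a ∈ S`, `b ∉ S` and `b` is reachable from `a` by an `r`-chain,
then some step `r x y` of the chain goes from `x ∈ S` to `y ∉ S`. [folklore] -/
theorem Relation.ReflTransGen.exists_mem_notMem {α : Type*} {r : α → α → Prop} {a b : α}
    (h : Relation.ReflTransGen r a b) {S : Set α} (ha : a ∈ S) (hb : b ∉ S) :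
    ∃ x ∈ S, ∃ y ∉ S, r x y := by
  induction h with
  | refl => exact absurd ha hb
  | @tail c d _ hcd ih =>
    by_cases hc : c ∈ S
    · exact ⟨c, hc, d, hb, hcd⟩
    · exact ih hc

namespace Summit.Langlands.Langlands.Theorems

variable {R : Type*} [CommRing R]

/-! ## 2. Chain form -/

/-- **Raynaud connectivity, chain form ⟹ `conn`.**  Let `Big` be any predicate on `Spec R`.  If any
two minimal primes `C, C'` of `R` are linked by a finite chain of minimal primes
`C = D₀, D₁, …, Dₙ = C'` such that consecutive members `Dᵢ, Dᵢ₊₁` lie below a common prime `Qᵢ`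
with `Big Qᵢ`, then for every two-colouring `S` of the minimal primes using both colours there are
minimal primes `C₁ ∈ S`, `C₂ ∉ S` below a common big prime (the colour flips at some consecutive
pair of the chain).  This is the last, combinatorial, step of [SW, §4.3, proof of Prop. 4.1].
[cite: SkinnerWiles1999, §4.3 proof of Prop. 4.1] -/
theorem conn_of_forall_minimalPrimes_reflTransGen (Big : PrimeSpectrum R → Prop)
    (hchain : ∀ C C' : PrimeSpectrum R, C.asIdeal ∈ minimalPrimes R → C'.asIdeal ∈ minimalPrimes R →
      Relation.ReflTransGen (fun D D' : PrimeSpectrum R => D.asIdeal ∈ minimalPrimes R ∧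
        D'.asIdeal ∈ minimalPrimes R ∧ ∃ Q : PrimeSpectrum R, D ≤ Q ∧ D' ≤ Q ∧ Big Q) C C')
    (S : Set (PrimeSpectrum R)) (h₁ : ∃ C ∈ S, C.asIdeal ∈ minimalPrimes R)
    (h₂ : ∃ C ∉ S, C.asIdeal ∈ minimalPrimes R) :
    ∃ C₁ ∈ S, ∃ C₂ ∉ S, C₁.asIdeal ∈ minimalPrimes R ∧ C₂.asIdeal ∈ minimalPrimes R ∧
      ∃ Q : PrimeSpectrum R, C₁ ≤ Q ∧ C₂ ≤ Q ∧ Big Q := by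
  obtain ⟨C, hCS, hC⟩ := h₁
  obtain ⟨C', hC'S, hC'⟩ := h₂
  obtain ⟨C₁, hC₁, C₂, hC₂, hmin₁, hmin₂, hQ⟩ := (hchain C C' hC hC').exists_mem_notMem hCS hC'S
  exact ⟨C₁, hC₁, C₂, hC₂, hmin₁, hmin₂, hQ⟩

/-- Chain form with the linkage relation and its bigness consequence separated: if every two minimal
primes are joined by a `link`-chain and every `link`-step between minimal primes is witnessed by a
common big prime, `conn` holds. [cite: SkinnerWiles1999, §4.3 proof of Prop. 4.1] -/
theorem conn_of_forall_minimalPrimes_reflTransGen' (Big : PrimeSpectrum R → Prop)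
    (link : PrimeSpectrum R → PrimeSpectrum R → Prop)
    (hlink : ∀ D D' : PrimeSpectrum R, D.asIdeal ∈ minimalPrimes R → D'.asIdeal ∈ minimalPrimes R →
      link D D' → ∃ Q : PrimeSpectrum R, D ≤ Q ∧ D' ≤ Q ∧ Big Q)
    (hchain : ∀ C C' : PrimeSpectrum R, C.asIdeal ∈ minimalPrimes R → C'.asIdeal ∈ minimalPrimes R →
      Relation.ReflTransGen (fun D D' : PrimeSpectrum R => D.asIdeal ∈ minimalPrimes R ∧
        D'.asIdeal ∈ minimalPrimes R ∧ link D D') C C')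
    (S : Set (PrimeSpectrum R)) (h₁ : ∃ C ∈ S, C.asIdeal ∈ minimalPrimes R)
    (h₂ : ∃ C ∉ S, C.asIdeal ∈ minimalPrimes R) :
    ∃ C₁ ∈ S, ∃ C₂ ∉ S, C₁.asIdeal ∈ minimalPrimes R ∧ C₂.asIdeal ∈ minimalPrimes R ∧
      ∃ Q : PrimeSpectrum R, C₁ ≤ Q ∧ C₂ ≤ Q ∧ Big Q := by
  refine conn_of_forall_minimalPrimes_reflTransGen Big (fun C C' hC hC' => ?_) S h₁ h₂
  exact Relation.ReflTransGen.mono (p := fun D D' : PrimeSpectrum R => D.asIdeal ∈ minimalPrimes R ∧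
      D'.asIdeal ∈ minimalPrimes R ∧ ∃ Q : PrimeSpectrum R, D ≤ Q ∧ D' ≤ Q ∧ Big Q)
    (fun D D' h => ⟨h.1, h.2.1, hlink D D' h.1 h.2.1 h.2.2⟩) C C' (hchain C C' hC hC')

/-! ## 3. Crossing form -/

/-- **A top-dimensional component of `V(J)`.**  If `n ≤ dim R/J` then some minimal prime `Q` of `J`
has `n ≤ dim R/Q`: a chain of primes of length `n` above `J` starts at a prime `𝔮 ⊇ J`, which lies
above a minimal prime `Q` of `J`, and `dim R/Q ≥ dim R/𝔮 ≥ n`. [folklore] -/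
theorem exists_minimalPrimes_le_ringKrullDim_quotient (J : Ideal R) (n : ℕ)
    (hn : (n : WithBot ℕ∞) ≤ ringKrullDim (R ⧸ J)) :
    ∃ Q : PrimeSpectrum R, Q.asIdeal ∈ J.minimalPrimes ∧ (n : WithBot ℕ∞) ≤ ringKrullDim (R ⧸ Q.asIdeal) := by
  rw [ringKrullDim_quotient, Order.le_krullDim_iff] at hn
  obtain ⟨l, hl⟩ := hn
  -- the chain `l` lives in `V(J)`; its head `𝔮 ⊇ J` lies above a minimal prime `Q` of `J`
  obtain ⟨Q, hQ, hQle⟩ := Ideal.exists_minimalPrimes_le (J := (l.head : PrimeSpectrum R).asIdeal) l.head.2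
  refine ⟨⟨Q, hQ.1.1⟩, hQ, ?_⟩
  -- `l` is also a chain in `V(Q)`
  let l' : LTSeries (PrimeSpectrum.zeroLocus (R := R) (Q : Set R)) :=
    LTSeries.mk l.length (fun i => ⟨(l i : PrimeSpectrum R), fun r hr =>
        (show Q ≤ (l i : PrimeSpectrum R).asIdeal from
          hQle.trans (Subtype.coe_le_coe.mpr (l.head_le i))) hr⟩)
      (fun i j hij => l.strictMono hij)
  have h1 : ((n : ℕ∞) : WithBot ℕ∞) = l'.length := by rw [← hl]; rfl
  rw [ringKrullDim_quotient]
  calc ((n : ℕ∞) : WithBot ℕ∞) = l'.length := h1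
    _ ≤ Order.krullDim _ := Order.LTSeries.length_le_krullDim l'

/-- **Raynaud connectivity, crossing form ⟹ `conn`.**  Let `Big` be any predicate on `Spec R` and
`n : ℕ`.  Suppose (G) `Spec R` is CONNECTED IN DIMENSION `n`: for every two-colouring of the minimal
primes using both colours, two minimal primes `C₁, C₂` of different colours have
`n ≤ dim R/(C₁ + C₂)` — the output of Grothendieck's connectedness theorem [SW, App. A, Cor. A.2] for
`R = A/(f₁,…,f_r)`, `A` complete local Cohen–Macaulay, `n = dim A − r − 1` —, and (B) for distinct
minimal primes `C₁, C₂`, every minimal prime `Q` of `C₁ + C₂` with `n ≤ dim R/Q` (the generic point of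
a `≥ n`-dimensional component of the crossing `V(C₁) ∩ V(C₂)`) is big.  Then `conn` holds.
[cite: SkinnerWiles1999, §4.3 proof of Prop. 4.1 and App. A Cor. A.2] -/
theorem conn_of_crossings (Big : PrimeSpectrum R → Prop) (n : ℕ)
    (hG : ∀ S : Set (PrimeSpectrum R),
      (∃ C ∈ S, C.asIdeal ∈ minimalPrimes R) → (∃ C ∉ S, C.asIdeal ∈ minimalPrimes R) →
        ∃ C₁ ∈ S, ∃ C₂ ∉ S, C₁.asIdeal ∈ minimalPrimes R ∧ C₂.asIdeal ∈ minimalPrimes R ∧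
          (n : WithBot ℕ∞) ≤ ringKrullDim (R ⧸ (C₁.asIdeal ⊔ C₂.asIdeal)))
    (hB : ∀ C₁ C₂ : PrimeSpectrum R, C₁.asIdeal ∈ minimalPrimes R → C₂.asIdeal ∈ minimalPrimes R →
      C₁ ≠ C₂ → ∀ Q : PrimeSpectrum R, Q.asIdeal ∈ (C₁.asIdeal ⊔ C₂.asIdeal).minimalPrimes →
        (n : WithBot ℕ∞) ≤ ringKrullDim (R ⧸ Q.asIdeal) → Big Q)
    (S : Set (PrimeSpectrum R)) (h₁ : ∃ C ∈ S, C.asIdeal ∈ minimalPrimes R)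
    (h₂ : ∃ C ∉ S, C.asIdeal ∈ minimalPrimes R) :
    ∃ C₁ ∈ S, ∃ C₂ ∉ S, C₁.asIdeal ∈ minimalPrimes R ∧ C₂.asIdeal ∈ minimalPrimes R ∧
      ∃ Q : PrimeSpectrum R, C₁ ≤ Q ∧ C₂ ≤ Q ∧ Big Q := by
  obtain ⟨C₁, hC₁, C₂, hC₂, hmin₁, hmin₂, hdim⟩ := hG S h₁ h₂
  obtain ⟨Q, hQ, hQdim⟩ := exists_minimalPrimes_le_ringKrullDim_quotient _ n hdim
  have hne : C₁ ≠ C₂ := fun h => hC₂ (h ▸ hC₁)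
  refine ⟨C₁, hC₁, C₂, hC₂, hmin₁, hmin₂, Q, ?_, ?_, hB C₁ C₂ hmin₁ hmin₂ hne Q hQ hQdim⟩
  · exact (PrimeSpectrum.asIdeal_le_asIdeal _ _).mp (le_sup_left.trans hQ.1.2)
  · exact (PrimeSpectrum.asIdeal_le_asIdeal _ _).mp (le_sup_right.trans hQ.1.2)

end Summit.Langlands.Langlands.Theorems

/-! ## 4. The registered sub-goals (verbatim signatures) -/

namespace Summit.Langlands.Langlands.Cruxes.ReducibleOrdinaryProModular.FineSelmerCodimensionTwo

/-- **Registered sub-goal `stub_raynaudConnectivity_auxChain` of stub `stub_raynaudConnectivity` (line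
`fine-selmer-codimension-two`, crux stmt-Langlands-12919): the chain form of Raynaud connectivity
implies the `conn` hypothesis of `Theorems.proMod_of_propagation`** — for ANY commutative ring and ANY
bigness predicate (`Theorems.conn_of_forall_minimalPrimes_reflTransGen`).
[cite: SkinnerWiles1999, §4.3 proof of Prop. 4.1] -/
theorem stub_raynaudConnectivity_auxChain :
    ∀ (R : Type) [CommRing R] (Big : PrimeSpectrum R → Prop),
      (∀ C C' : PrimeSpectrum R, C.asIdeal ∈ minimalPrimes R → C'.asIdeal ∈ minimalPrimes R →
        Relation.ReflTransGen (fun D D' : PrimeSpectrum R => D.asIdeal ∈ minimalPrimes R ∧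
          D'.asIdeal ∈ minimalPrimes R ∧ ∃ Q : PrimeSpectrum R, D ≤ Q ∧ D' ≤ Q ∧ Big Q) C C') →
      ∀ S : Set (PrimeSpectrum R),
        (∃ C ∈ S, C.asIdeal ∈ minimalPrimes R) → (∃ C ∉ S, C.asIdeal ∈ minimalPrimes R) →
        ∃ C₁ ∈ S, ∃ C₂ ∉ S, C₁.asIdeal ∈ minimalPrimes R ∧ C₂.asIdeal ∈ minimalPrimes R ∧
          ∃ Q : PrimeSpectrum R, C₁ ≤ Q ∧ C₂ ≤ Q ∧ Big Q :=
  fun _ _ Big hchain S h₁ h₂ => Theorems.conn_of_forall_minimalPrimes_reflTransGen Big hchain S h₁ h₂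

/-- **Registered sub-goal `stub_raynaudConnectivity_auxCrossing` of stub `stub_raynaudConnectivity`:
connectedness of `Spec R` in dimension `n` (the output of Grothendieck's connectedness theorem,
[SW, App. A, Cor. A.2]) together with bigness of the generic points of the `≥ n`-dimensional
components of the crossings of distinct components implies `conn`** (`Theorems.conn_of_crossings`).
[cite: SkinnerWiles1999, §4.3 proof of Prop. 4.1 and App. A Cor. A.2] -/
theorem stub_raynaudConnectivity_auxCrossing :
    ∀ (R : Type) [CommRing R] (Big : PrimeSpectrum R → Prop) (n : ℕ),
      (∀ S : Set (PrimeSpectrum R),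
        (∃ C ∈ S, C.asIdeal ∈ minimalPrimes R) → (∃ C ∉ S, C.asIdeal ∈ minimalPrimes R) →
          ∃ C₁ ∈ S, ∃ C₂ ∉ S, C₁.asIdeal ∈ minimalPrimes R ∧ C₂.asIdeal ∈ minimalPrimes R ∧
            (n : WithBot ℕ∞) ≤ ringKrullDim (R ⧸ (C₁.asIdeal ⊔ C₂.asIdeal))) →
      (∀ C₁ C₂ : PrimeSpectrum R, C₁.asIdeal ∈ minimalPrimes R → C₂.asIdeal ∈ minimalPrimes R →
        C₁ ≠ C₂ → ∀ Q : PrimeSpectrum R, Q.asIdeal ∈ (C₁.asIdeal ⊔ C₂.asIdeal).minimalPrimes →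
          (n : WithBot ℕ∞) ≤ ringKrullDim (R ⧸ Q.asIdeal) → Big Q) →
      ∀ S : Set (PrimeSpectrum R),
        (∃ C ∈ S, C.asIdeal ∈ minimalPrimes R) → (∃ C ∉ S, C.asIdeal ∈ minimalPrimes R) →
        ∃ C₁ ∈ S, ∃ C₂ ∉ S, C₁.asIdeal ∈ minimalPrimes R ∧ C₂.asIdeal ∈ minimalPrimes R ∧
          ∃ Q : PrimeSpectrum R, C₁ ≤ Q ∧ C₂ ≤ Q ∧ Big Q :=
  fun _ _ Big n hG hB S h₁ h₂ => Theorems.conn_of_crossings Big n hG hB S h₁ h₂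

end Summit.Langlands.Langlands.Cruxes.ReducibleOrdinaryProModular.FineSelmerCodimensionTwo
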